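import Summits.Ventures.CertifiedManyBodySolver.Downfold.EmeryFermiFillingCCOCSubs
import Summits.Ventures.CertifiedManyBodySolver.Downfold.EmeryFermiFillingLa214
import Summits.Ventures.CertifiedManyBodySolver.Downfold.EmeryBoxesKSlicesB
import HarnessLib

/-!
# Ca₂₋ₓNaₓCuO₂Cl₂ (box #36 CCOC, (K) source rows): the typed 3BE one-body box `emeryBoxCCOCK26Src` ⇒ a CERTIFIED window for the object-E Fermi-surface `t′/t` of the σ three-band
# model at the box's own hole count — and a certified MODEL-FORM CEILING against the E row of record

Venture CertifiedManyBodySolver, cell `pub/hubbard-downfold` (stage S1, HUMAN RULINGS D-0096/D-0098), seat hubbard-downfold-mod-4 (technique B = band level);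
namespace `Summit.Ventures.CertifiedManyBodySolver.Downfold.Emery`. Everything PROVED; numerics decided by the kernel (`EmeryFermiFillingCCOCSubs`).
Same device as `EmeryFermiFillingLa214` / `EmeryFermiFillingHg1201` / `EmeryFermiFillingLSCO`.

THE STATEMENT (`emeryBoxCCOCK26Src_fsRatio_window`). For every parameter vector of `emeryBoxCCOCK26Src` (`EmeryBoxesKSlicesB`: the CCOC companion's ONE-BODY rows with the DFT-level Δ_pd sub-range (source box of the (K) U-slice), n_H = 1.10 (x = 0.10), filling padded ±0.005: Δ_pd [2.05, 2.66] × t_pd [1.17, 1.39] × t_pp [0.58, 0.69] × t_pp′ [0.13, 0.136]; n_H ∈ [1.1, 1.1])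
and every Fermi energy ε with `abFilling(ε) = (2 − n_H)/2` (the σ-model antibonding band holds the box's own electrons):
**`t′/t = fsRatio(ε) ∈ [-0.2954, -0.232]`** and **ε ∈ [1.2, 2.06]** (box units, eV above ε_d).

READING (certified): the box's object-E row of record `t′/t (E) ∈ [−0.41, −0.30]` (box CCOC-Na010.md l.43) vs the σ-model Fermi-surface window [-0.2954, -0.232] on the whole one-body box at its own hole count —
see the corollary below: DISJOINT ⇒ a certified MODEL-FORM CEILING (the d–p_x–p_y(+t_pp, t_pp′) model cannot produce the one-band Fermi-surface shape of record anywhere in the box;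
the axial Cu-4s / apical / reservoir channel of [PavariniEtAl2001] carries the rest); INSIDE ⇒ consistency; partial overlap ⇒ a cut by sub-box (table in the Subs file).

WHAT THIS IS NOT: not a statement that the material's parameters ARE in the box (SCREENING-GRADE provenance); the theorem certifies the REDUCTION STEP
of the σ d–p_x–p_y(+t_pp, t_pp′) model only; not the interaction (`U`) reduction; no phase sentence. Sources: [HybertsenSchluterChristensen1989, Eq. (1)];
[AndersenEtAl1995, §6]; [PavariniEtAl2001, Eq. (1)].
-/

noncomputable section

namespace Summit.Ventures.CertifiedManyBodySolver.Downfold.Emery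

open Real Set
open Summit.Ventures.CertifiedManyBodySolver.Downfold

/-- Per-spin antibonding filling from the box's hole count: `n_H ∈ [11/10, 11/10] ⇒ (2 − n_H)/2 ∈ [89/200, 91/200]`. [folklore] -/
theorem abFilling_rowCCOC_of_nHoles {nH f : ℝ} (h1 : (11 / 10 : ℝ) ≤ nH) (h2 : nH ≤ (11 / 10 : ℝ)) (hf : f = (2 - nH) / 2) :
    f ∈ Set.Icc (89 / 200 : ℝ) (91 / 200 : ℝ) := by
  rw [hf]; constructor <;> linarith

/-- **Ca₂₋ₓNaₓCuO₂Cl₂ (box #36 CCOC, (K) source rows): 3BE box ⇒ object-E `t′/t` window (raw coordinates)** at per-spin filling ∈ [0.445, 0.455]: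
`ε ∈ [1.2, 2.06]` and `t′/t ∈ [-0.2954, -0.232]`. [folklore] -/
theorem ccocBox_fsRatio_window {Δ tpd tpp c ε : ℝ} (hΔ : Δ ∈ Set.Icc (41 / 20 : ℝ) (133 / 50 : ℝ))
    (ha : tpd ∈ Set.Icc (117 / 100 : ℝ) (139 / 100 : ℝ)) (hb : tpp ∈ Set.Icc (29 / 50 : ℝ) (69 / 100 : ℝ))
    (hc : c ∈ Set.Icc (13 / 100 : ℝ) (17 / 125 : ℝ))
    (hν : abFilling Δ tpd tpp c ε ∈ Set.Icc (89 / 200 : ℝ) (91 / 200 : ℝ)) :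
    ε ∈ Set.Icc (6 / 5 : ℝ) (103 / 50 : ℝ) ∧ fsRatio Δ tpd tpp c ε ∈ Set.Icc (-(1477 / 5000 : ℝ)) (-(29 / 125 : ℝ)) := by
  have hΔ' := hΔ
  constructor
  · clear hΔ
    rcases mem_Icc_split hΔ' (471 / 200 : ℝ) with hΔ' | hΔ'
    · rcases mem_Icc_split hΔ' (881 / 400 : ℝ) with hΔ' | hΔ'
      · rcases mem_Icc_split ha (32 / 25 : ℝ) with ha' | ha'
        · have h := (ccocSub_0_0 hΔ' ha' hb hc hν).1
          exact ⟨le_trans (by norm_num) h.1, h.2.trans (by norm_num)⟩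
        · have h := (ccocSub_0_1 hΔ' ha' hb hc hν).1
          exact ⟨le_trans (by norm_num) h.1, h.2.trans (by norm_num)⟩
      · rcases mem_Icc_split ha (32 / 25 : ℝ) with ha' | ha'
        · have h := (ccocSub_1_0 hΔ' ha' hb hc hν).1
          exact ⟨le_trans (by norm_num) h.1, h.2.trans (by norm_num)⟩
        · have h := (ccocSub_1_1 hΔ' ha' hb hc hν).1
          exact ⟨le_trans (by norm_num) h.1, h.2.trans (by norm_num)⟩
    · rcases mem_Icc_split hΔ' (1003 / 400 : ℝ) with hΔ' | hΔ'
      · rcases mem_Icc_split ha (32 / 25 : ℝ) with ha' | ha'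
        · have h := (ccocSub_2_0 hΔ' ha' hb hc hν).1
          exact ⟨le_trans (by norm_num) h.1, h.2.trans (by norm_num)⟩
        · have h := (ccocSub_2_1 hΔ' ha' hb hc hν).1
          exact ⟨le_trans (by norm_num) h.1, h.2.trans (by norm_num)⟩
      · rcases mem_Icc_split ha (32 / 25 : ℝ) with ha' | ha'
        · have h := (ccocSub_3_0 hΔ' ha' hb hc hν).1
          exact ⟨le_trans (by norm_num) h.1, h.2.trans (by norm_num)⟩
        · have h := (ccocSub_3_1 hΔ' ha' hb hc hν).1
          exact ⟨le_trans (by norm_num) h.1, h.2.trans (by norm_num)⟩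
  · clear hΔ
    rcases mem_Icc_split hΔ' (471 / 200 : ℝ) with hΔ' | hΔ'
    · rcases mem_Icc_split hΔ' (881 / 400 : ℝ) with hΔ' | hΔ'
      · rcases mem_Icc_split ha (32 / 25 : ℝ) with ha' | ha'
        · have h := (ccocSub_0_0 hΔ' ha' hb hc hν).2
          exact ⟨le_trans (by norm_num) h.1, h.2.trans (by norm_num)⟩
        · have h := (ccocSub_0_1 hΔ' ha' hb hc hν).2
          exact ⟨le_trans (by norm_num) h.1, h.2.trans (by norm_num)⟩
      · rcases mem_Icc_split ha (32 / 25 : ℝ) with ha' | ha'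
        · have h := (ccocSub_1_0 hΔ' ha' hb hc hν).2
          exact ⟨le_trans (by norm_num) h.1, h.2.trans (by norm_num)⟩
        · have h := (ccocSub_1_1 hΔ' ha' hb hc hν).2
          exact ⟨le_trans (by norm_num) h.1, h.2.trans (by norm_num)⟩
    · rcases mem_Icc_split hΔ' (1003 / 400 : ℝ) with hΔ' | hΔ'
      · rcases mem_Icc_split ha (32 / 25 : ℝ) with ha' | ha'
        · have h := (ccocSub_2_0 hΔ' ha' hb hc hν).2
          exact ⟨le_trans (by norm_num) h.1, h.2.trans (by norm_num)⟩
        · have h := (ccocSub_2_1 hΔ' ha' hb hc hν).2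
          exact ⟨le_trans (by norm_num) h.1, h.2.trans (by norm_num)⟩
      · rcases mem_Icc_split ha (32 / 25 : ℝ) with ha' | ha'
        · have h := (ccocSub_3_0 hΔ' ha' hb hc hν).2
          exact ⟨le_trans (by norm_num) h.1, h.2.trans (by norm_num)⟩
        · have h := (ccocSub_3_1 hΔ' ha' hb hc hν).2
          exact ⟨le_trans (by norm_num) h.1, h.2.trans (by norm_num)⟩

/-- The five rows of `emeryBoxCCOCK26Src` this file reads. [folklore] -/
theorem emeryBoxCCOCK26Src_mem_rows {p : EmeryCoord → ℝ} (hp : emeryBoxCCOCK26Src.Mem p) :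
    p .DeltaPd ∈ Set.Icc (41 / 20 : ℝ) (133 / 50 : ℝ) ∧ p .tpd ∈ Set.Icc (117 / 100 : ℝ) (139 / 100 : ℝ) ∧
      p .tpp ∈ Set.Icc (29 / 50 : ℝ) (69 / 100 : ℝ) ∧ p .tppP ∈ Set.Icc (13 / 100 : ℝ) (17 / 125 : ℝ) ∧
      p .nHoles ∈ Set.Icc (11 / 10 : ℝ) (11 / 10 : ℝ) := by
  have hΔ := (Entry.mem_ofEnds_iff _ _ _ _ _).1 (hp .DeltaPd ccocK26Emery_DeltaKS rfl)
  have ha := (Entry.mem_ofEnds_iff _ _ _ _ _).1 (hp .tpd ccocK26Emery_tpd rfl)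
  have hb := (Entry.mem_ofEnds_iff _ _ _ _ _).1 (hp .tpp ccocK26Emery_tpp rfl)
  have hc := (Entry.mem_ofEnds_iff _ _ _ _ _).1 (hp .tppP ccocK26Emery_tppP rfl)
  have hn := (Entry.mem_ofEnds_iff _ _ _ _ _).1 (hp .nHoles ccocK26Emery_nH rfl)
  push_cast at hΔ ha hb hc hn
  exact ⟨⟨hΔ.1, hΔ.2⟩, ⟨ha.1, ha.2⟩, ⟨hb.1, hb.2⟩, ⟨hc.1, hc.2⟩, ⟨hn.1, hn.2⟩⟩

/-- **THE WORD ON THE TYPED BOX `emeryBoxCCOCK26Src`**: at every parameter vector and every Fermi energy at which the σ-model antibonding band holds the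
box's own electron count, `ε ∈ [1.2, 2.06]` and the exact σ-model Fermi-surface `t′/t ∈ [-0.2954, -0.232]`.
[cite: HybertsenSchluterChristensen1989, Eq. (1) (three-band d–p model)] -/
theorem emeryBoxCCOCK26Src_fsRatio_window :
    HoldsOn (fun p : EmeryCoord → ℝ => ∀ ε : ℝ,
      abFilling (p .DeltaPd) (p .tpd) (p .tpp) (p .tppP) ε = (2 - p .nHoles) / 2 →
      ε ∈ Set.Icc (6 / 5 : ℝ) (103 / 50 : ℝ) ∧
      fsRatio (p .DeltaPd) (p .tpd) (p .tpp) (p .tppP) ε ∈ Set.Icc (-(1477 / 5000 : ℝ)) (-(29 / 125 : ℝ))) emeryBoxCCOCK26Src := by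
  intro p hp ε hf
  obtain ⟨hΔ, ha, hb, hc, hn⟩ := emeryBoxCCOCK26Src_mem_rows hp
  exact ccocBox_fsRatio_window hΔ ha hb hc (abFilling_rowCCOC_of_nHoles hn.1 hn.2 hf)

/-- **MODEL-FORM CEILING, CERTIFIED**: on the whole box the σ-model Fermi-surface `t′/t` window [-0.2954, -0.232] is DISJOINT from the object-E
row of record `[-0.41, -0.3]` (router/BOXES/CCOC-Na010.md l.43 «tp/t (E) [−0.41, −0.30]») — the d–p_x–p_y(+t_pp, t_pp′) model cannot produce this material's one-band Fermi-surface
shape anywhere in its 3BE box. [folklore] -/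
theorem emeryBoxCCOCK26Src_fsRatio_not_objectE :
    HoldsOn (fun p : EmeryCoord → ℝ => ∀ ε : ℝ,
      abFilling (p .DeltaPd) (p .tpd) (p .tpp) (p .tppP) ε = (2 - p .nHoles) / 2 →
      fsRatio (p .DeltaPd) (p .tpd) (p .tpp) (p .tppP) ε ∉ Set.Icc (-(41 / 100 : ℝ)) (-(3 / 10 : ℝ))) emeryBoxCCOCK26Src := by
  intro p hp ε hf hmem
  have h := (emeryBoxCCOCK26Src_fsRatio_window p hp ε hf).2
  have : (-(3 / 10 : ℝ)) < (-(1477 / 5000 : ℝ)) := by norm_num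
  linarith [h.1, hmem.2]

end Summit.Ventures.CertifiedManyBodySolver.Downfold.Emery
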